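import Literature.NumberTheory.EllipticCurves.IwasawaAlgebraSpecializationIndexProofs
import HarnessLib

/-!
# Specialised indices `#(N ⧸ Q N) ≍ #(Λ ⧸ (Q, char N))` at distinguished `Q` prime to `char N`
# (the specialisation principle in index currency; module theory over `Λ = ℤ_p⟦T⟧`, proofs file)

Topic `NumberTheory/EllipticCurves`. THEOREMS ONLY (no definition, no named fact, no `sorry`), on the vocabulary
of `IwasawaAlgebra.lean` (`elementaryModule`, `charElement`, `Module.charIdeal`) and its proof files
(`exists_isPseudoIsomorphism_elementary_holds`, `charIdeal_eq_span_holds`, `finite_of_isPseudoNull`,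
`eq_span_of_height_eq_one`), the counting file `IwasawaAlgebraSpecializationCountProofs` (`#((Λ/J) ⧸ I) = #(Λ ⧸ (J ⊔ I))`,
`#(Λ ⧸ (J, p^k)) = p^{k · rank}`) and the comparison file `IwasawaAlgebraSpecializationIndexComparisonProofs`
(`LinearMap.IsPseudoIsomorphism.exists_card_quotient_le`). Sibling of `IwasawaAlgebraSpecializationIndexProofs`, which
treats only Howard's `μ`-primes `q_m = T^m + p`; this file treats an ARBITRARY distinguished polynomial `Q` relatively
prime to the characteristic power series — the height-one primes `(Q)`, `Q` distinguished irreducible, are exactly the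
primes `≠ (p)` at which a `Λ`-adic Kolyvagin / Euler system argument is specialised (Mazur–Rubin, *Kolyvagin systems*,
§5.3, proof of Thm. 5.3.10: "`𝔓` a height-one prime of `Λ`, `S_𝔓` the integral closure of `Λ/𝔓` …"; Howard 2004, proof of
Thm. 2.2.10), and `#(Λ ⧸ (Q, g)) = |N_{ℚ_p(x)/ℚ_p} g(x)|_p^{-1}` (`x` a root of `Q`) is how such a specialised bound is READ
as a statement about the value `g(x)` of the characteristic power series. Written by the lead seat of line `birth` on
crux K1 `CumulativeHeegnerInclusionAtThree` (stmt-BirchSwinnertonDyer-24198, route `CumulativeHeegnerLeopoldt`; research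
child A = stmt-26896) as the algebraic core of the «specialisation-wise Kolyvagin-system bound ⟹ domination
`‖L(x)‖ ≤ C ‖g(x)‖`» step of the tempered line (memo TEMPERED-LINE-VIABILITY-g4 §2 (d♮)). HONEST FRAMING: pure `Λ`-module
algebra; nothing about elliptic curves is asserted; BSD is not proved by any of this.

WHAT (`Q` a distinguished polynomial, coerced to `Λ`; `#(N ⧸ Q N)` spelled `Nat.card (N ⧸ (Ideal.span {Q} • ⊤))`;
`(Q, a)` spelled `Ideal.span {Q} ⊔ Ideal.span {a}`; no new definitions).
* §1 **`card_quotient_span_sup_span_mul`** — MULTIPLICATIVITY: for `b` relatively prime to `q` (any `q ∈ Λ`),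
  `#(Λ ⧸ (q, ab)) = #(Λ ⧸ (q, a)) · #(Λ ⧸ (q, b))` (`b` is a non-zero-divisor modulo `q` since `Λ` is a UFD, so
  `0 → Λ/(q,a) —·b→ Λ/(q,ab) → Λ/(q,b) → 0` is exact; `Nat.card`, no finiteness needed); list version
  `card_quotient_span_sup_span_list_prod`.
* §2 `card_quotient_span_coe_sup_span_C_pow` (`#(Λ ⧸ (Q, p^μ)) = p^{μ deg Q}`), `not_C_dvd_coe_of_monic`,
  `isRelPrime_C_pow_coe_of_monic` (`p ∤ Q`), and **`card_elementaryModule_quotSMulTop_eq`**: for the elementary module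
  `E = E(μs, fs)` and `Q` distinguished, relatively prime to every `fⱼ`,
  `#(E ⧸ Q E) = #(Λ ⧸ (Q, char E))`, `char E = p^{Σμᵢ} ∏ fⱼ^{nⱼ}` (EXACT).
* §3 **`finite_quotient_span_coe_sup_span`** — `Λ ⧸ (Q, f)` is FINITE for `Q` distinguished and `f` relatively prime to
  `Q` (no height-one prime contains `(Q, f)`: not `(p)` since `Q` is monic, not `(h)` by coprimality; so the quotient is
  pseudo-null, hence finite).
* §4 **`exists_card_quotSMulTop_bounds_of_isRelPrime`** — THE PRINCIPLE: for a finitely generated torsion `Λ`-module `N`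
  there is `B ≥ 1` such that for EVERY distinguished `Q` relatively prime to a generator of `char N`: `N ⧸ Q N` is finite,
  `#(Λ ⧸ (Q, char N)) ≤ B · #(N ⧸ Q N)` and `#(N ⧸ Q N) ≤ B · #(Λ ⧸ (Q, char N))` (`B = #ker θ · #coker θ` for a
  structure pseudo-isomorphism `θ : N → E`, uniform in `Q`).

References: [MazurRubin2004] B. Mazur, K. Rubin, *Kolyvagin systems*, Mem. AMS 799 (2004), §5.3 (Thm. 5.3.10 and its
proof: specialisation at height-one primes); [Howard2004HeegnerKolyvagin] B. Howard, *The Heegner point Kolyvagin system*,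
Compositio Math. 140 (2004), proof of Thm. 2.2.10; [Washington1997] L. Washington, *Introduction to Cyclotomic Fields*,
§7.1 (Prop. 7.2, distinguished polynomials), §13.2 (Lemma 13.7, Prop. 13.8, Thm. 13.12); [NeukirchSchmidtWingberg2008]
Ch. V §3 ((5.3.7)–(5.3.8): the primes of `Λ`; pseudo-null = finite).
-/

set_option autoImplicit false

noncomputable section

open scoped Classical Pointwise Polynomial DirectSum

namespace Literature.NumberTheory.EllipticCurves

namespace IwasawaAlgebra

variable (p : ℕ) [Fact p.Prime]

/-! ### §1 Multiplicativity of `#(Λ ⧸ (q, ·))` on elements prime to `q` -/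

/-- **Multiplicativity.** If `b` is relatively prime to `q` in the UFD `Λ = ℤ_[p]⟦T⟧`, then
`#(Λ ⧸ (q, ab)) = #(Λ ⧸ (q, a)) · #(Λ ⧸ (q, b))`: `b` is a non-zero-divisor modulo `q`, so multiplication by `b`
induces `Λ ⧸ (q, a) ≅ (q, b)/(q, ab)`, and `(Λ ⧸ (q, ab)) ⧸ ((q, b)/(q, ab)) ≅ Λ ⧸ (q, b)` (Lagrange for `Nat.card`; no
finiteness hypothesis). [cite: Washington1997, §13.2 (Lemma 13.7: index computations in Λ/(f, g))]
[cite: MazurRubin2004, §5.3 (proof of Thm. 5.3.10, lengths over S_𝔓)] -/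
theorem card_quotient_span_sup_span_mul {q b : IwasawaAlgebra p} (a : IwasawaAlgebra p)
    (hb : IsRelPrime b q) :
    Nat.card (IwasawaAlgebra p ⧸ (Ideal.span {q} ⊔ Ideal.span {a * b})) =
      Nat.card (IwasawaAlgebra p ⧸ (Ideal.span {q} ⊔ Ideal.span {a})) *
        Nat.card (IwasawaAlgebra p ⧸ (Ideal.span {q} ⊔ Ideal.span {b})) := by
  set Jab : Ideal (IwasawaAlgebra p) := Ideal.span {q} ⊔ Ideal.span {a * b} with hJab
  set Ja : Ideal (IwasawaAlgebra p) := Ideal.span {q} ⊔ Ideal.span {a} with hJa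
  set Jb : Ideal (IwasawaAlgebra p) := Ideal.span {q} ⊔ Ideal.span {b} with hJb
  -- multiplication by `b`, followed by reduction modulo `(q, ab)`
  let ψ : IwasawaAlgebra p →ₗ[IwasawaAlgebra p] (IwasawaAlgebra p ⧸ Jab) :=
    (Submodule.mkQ Jab) ∘ₗ LinearMap.mulLeft (IwasawaAlgebra p) b
  have hψ : ∀ x, ψ x = Submodule.Quotient.mk (b * x) := fun x => rfl
  -- its kernel is `(q, a)`
  have hker : LinearMap.ker ψ = Ja := by
    ext x
    rw [LinearMap.mem_ker, hψ, Submodule.Quotient.mk_eq_zero]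
    constructor
    · intro hx
      obtain ⟨c, y, hy, hcy⟩ := Ideal.mem_span_singleton_sup.mp hx
      obtain ⟨d, rfl⟩ := Ideal.mem_span_singleton'.mp hy
      have hdvd : q ∣ b * (x - d * a) := ⟨c, by linear_combination (-1 : IwasawaAlgebra p) * hcy⟩
      obtain ⟨e, he⟩ := hb.symm.dvd_of_dvd_mul_left hdvd
      exact Ideal.mem_span_singleton_sup.mpr ⟨e, d * a, Ideal.mem_span_singleton'.mpr ⟨d, rfl⟩,
        by linear_combination (-1 : IwasawaAlgebra p) * he⟩
    · intro hx
      obtain ⟨c, y, hy, hcy⟩ := Ideal.mem_span_singleton_sup.mp hx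
      obtain ⟨d, rfl⟩ := Ideal.mem_span_singleton'.mp hy
      exact Ideal.mem_span_singleton_sup.mpr ⟨b * c, d * (a * b), Ideal.mem_span_singleton'.mpr ⟨d, rfl⟩,
        by linear_combination b * hcy⟩
  -- its range is `(q, b)/(q, ab)`
  have hrange : LinearMap.range ψ =
      ((Jb.map (Ideal.Quotient.mk Jab)).restrictScalars (IwasawaAlgebra p)) := by
    ext y
    constructor
    · rintro ⟨x, rfl⟩
      rw [Submodule.restrictScalars_mem, hψ]
      exact Ideal.mem_map_of_mem _ (Ideal.mem_sup_right (Ideal.mem_span_singleton'.mpr ⟨x, mul_comm x b⟩))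
    · intro hy
      rw [Submodule.restrictScalars_mem,
        Ideal.mem_map_iff_of_surjective _ Ideal.Quotient.mk_surjective] at hy
      obtain ⟨x, hx, rfl⟩ := hy
      obtain ⟨c, z, hz, hcz⟩ := Ideal.mem_span_singleton_sup.mp hx
      obtain ⟨d, rfl⟩ := Ideal.mem_span_singleton'.mp hz
      refine ⟨d, ?_⟩
      rw [hψ]
      change Submodule.Quotient.mk (b * d) = (Submodule.Quotient.mk x : IwasawaAlgebra p ⧸ Jab)
      rw [Submodule.Quotient.eq, ← hcz]
      exact Ideal.mem_sup_left (Ideal.mem_span_singleton'.mpr ⟨-c, by ring⟩)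
  -- cardinalities
  have h1 : Nat.card (IwasawaAlgebra p ⧸ Ja) = Nat.card (LinearMap.range ψ) :=
    Nat.card_congr ((Submodule.quotEquivOfEq _ _ hker.symm).trans (LinearMap.quotKerEquivRange ψ)).toEquiv
  have h2 : Nat.card (LinearMap.range ψ) = Nat.card (Jb.map (Ideal.Quotient.mk Jab)) := by
    rw [hrange]; rfl
  have h3 : Nat.card ((IwasawaAlgebra p ⧸ Jab) ⧸ Jb.map (Ideal.Quotient.mk Jab)) =
      Nat.card (IwasawaAlgebra p ⧸ Jb) := by
    have hsup : Jab ⊔ Jb = Jb := sup_eq_right.mpr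
      (sup_le_sup_left (Ideal.span_singleton_le_span_singleton.mpr (dvd_mul_left b a)) _)
    exact (Nat.card_congr (DoubleQuot.quotQuotEquivQuotSup Jab Jb).toEquiv).trans
      (Nat.card_congr (Ideal.quotEquivOfEq hsup).toEquiv)
  rw [Submodule.card_eq_card_quotient_mul_card (Jb.map (Ideal.Quotient.mk Jab)), h3, ← h2, ← h1]

/-- Relative primality to `q` is stable under list products.
[cite: Washington1997, §13.2 (Lemma 13.7)] -/
theorem isRelPrime_list_prod_left {q : IwasawaAlgebra p} :
    ∀ l : List (IwasawaAlgebra p), (∀ b ∈ l, IsRelPrime b q) → IsRelPrime l.prod q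
  | [], _ => by rw [List.prod_nil]; exact isRelPrime_one_left
  | (b :: l), h => by
    rw [List.prod_cons]
    exact IsRelPrime.mul_left (h b List.mem_cons_self)
      (isRelPrime_list_prod_left l fun c hc => h c (List.mem_cons_of_mem _ hc))

/-- **Multiplicativity over a list**: for `b₁, …, bₙ` each relatively prime to `q`,
`#(Λ ⧸ (q, ∏ bᵢ)) = ∏ #(Λ ⧸ (q, bᵢ))`. [cite: Washington1997, §13.2 (Lemma 13.7)] -/
theorem card_quotient_span_sup_span_list_prod {q : IwasawaAlgebra p} :
    ∀ l : List (IwasawaAlgebra p), (∀ b ∈ l, IsRelPrime b q) →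
      Nat.card (IwasawaAlgebra p ⧸ (Ideal.span {q} ⊔ Ideal.span {l.prod})) =
        (l.map fun b => Nat.card (IwasawaAlgebra p ⧸ (Ideal.span {q} ⊔ Ideal.span {b}))).prod
  | [], _ => by
    rw [List.prod_nil, List.map_nil, List.prod_nil, Ideal.span_singleton_one, sup_top_eq]
    haveI : Subsingleton (IwasawaAlgebra p ⧸ (⊤ : Ideal (IwasawaAlgebra p))) :=
      Ideal.Quotient.subsingleton_iff.mpr rfl
    exact Nat.card_of_subsingleton (0 : IwasawaAlgebra p ⧸ (⊤ : Ideal (IwasawaAlgebra p)))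
  | (b :: l), h => by
    have hl : ∀ c ∈ l, IsRelPrime c q := fun c hc => h c (List.mem_cons_of_mem _ hc)
    rw [List.prod_cons, List.map_cons, List.prod_cons,
      card_quotient_span_sup_span_mul p b (isRelPrime_list_prod_left p l hl),
      card_quotient_span_sup_span_list_prod l hl]

/-! ### §2 Counting the elementary module modulo a distinguished `Q` -/

/-- `#(Λ ⧸ (Q, p^μ)) = p^{μ · deg Q}` for a distinguished `Q` (`Λ/(Q)` is `ℤ_p`-free of rank `deg Q`).
[cite: Washington1997, §13.2 (Prop. 13.8 and Lemma 13.7)] -/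
theorem card_quotient_span_coe_sup_span_C_pow {Q : ℤ_[p][X]}
    (hQ : Q.IsDistinguishedAt (IsLocalRing.maximalIdeal ℤ_[p])) (μ : ℕ) :
    Nat.card (IwasawaAlgebra p ⧸ (Ideal.span {(Q : IwasawaAlgebra p)} ⊔
      Ideal.span {PowerSeries.C ((p : ℤ_[p]) ^ μ)})) = p ^ (μ * Q.natDegree) := by
  haveI := free_quotient_pow p hQ 1
  haveI := finite_quotient_pow p hQ 1
  have h1 : Ideal.span {(Q : IwasawaAlgebra p)} = Ideal.span {(Q : IwasawaAlgebra p) ^ 1} := by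
    rw [pow_one]
  rw [h1, card_quotient_sup_span_C_pow, finrank_quotient_pow p hQ 1, one_mul]

/-- `p ∤ Q` in `Λ` for a monic polynomial `Q` (its leading coefficient is `1`).
[cite: Washington1997, §7.1 (distinguished polynomials)] -/
theorem not_C_dvd_coe_of_monic {Q : ℤ_[p][X]} (hQ : Q.Monic) :
    ¬ (PowerSeries.C (p : ℤ_[p]) : IwasawaAlgebra p) ∣ (Q : IwasawaAlgebra p) := by
  intro h
  rw [Literature.NumberTheory.EllipticCurves.PowerSeries.C_dvd_iff_forall_dvd_coeff] at h
  have h1 := h Q.natDegree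
  rw [Polynomial.coeff_coe, hQ.coeff_natDegree] at h1
  exact PadicInt.prime_p.not_dvd_one h1

/-- `p^μ` is relatively prime to a monic `Q` in `Λ` (`p` is a prime element not dividing `Q`).
[cite: Washington1997, §7.1 and §13.2] -/
theorem isRelPrime_C_pow_coe_of_monic {Q : ℤ_[p][X]} (hQ : Q.Monic) (μ : ℕ) :
    IsRelPrime (PowerSeries.C ((p : ℤ_[p]) ^ μ) : IwasawaAlgebra p) (Q : IwasawaAlgebra p) := by
  rw [map_pow]
  exact IsRelPrime.pow_left
    ((prime_C p).irreducible.isRelPrime_iff_not_dvd.mpr (not_C_dvd_coe_of_monic p hQ))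

/-- **`#(E(μs, fs) ⧸ Q) = #(Λ ⧸ (Q, p^{Σμᵢ} ∏ fⱼ^{nⱼ}))`** for a distinguished `Q` relatively prime to every `fⱼ`:
the elementary module modulo `Q` is counted EXACTLY by the characteristic power series modulo `Q`
(piece by piece: `#((Λ/(p^μ)) ⧸ Q) = p^{μ deg Q}`, `#((Λ/(fⁿ)) ⧸ Q) = #(Λ ⧸ (Q, fⁿ))`, reassembled by multiplicativity).
[cite: Washington1997, §13.2 (Thm. 13.12 and Lemma 13.7)] [cite: MazurRubin2004, §5.3 (proof of Thm. 5.3.10)] -/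
theorem card_elementaryModule_quotSMulTop_eq {μs : List ℕ} {fs : List (ℤ_[p][X] × ℕ)} {Q : ℤ_[p][X]}
    (hQ : Q.IsDistinguishedAt (IsLocalRing.maximalIdeal ℤ_[p]))
    (hcop : ∀ f ∈ fs, IsRelPrime (f.1 : IwasawaAlgebra p) (Q : IwasawaAlgebra p)) :
    Nat.card ((elementaryModule p μs fs) ⧸
      (Ideal.span {(Q : IwasawaAlgebra p)} • ⊤ : Submodule (IwasawaAlgebra p) (elementaryModule p μs fs))) =
      Nat.card (IwasawaAlgebra p ⧸ (Ideal.span {(Q : IwasawaAlgebra p)} ⊔ Ideal.span {charElement p μs fs})) := by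
  set q : IwasawaAlgebra p := (Q : IwasawaAlgebra p) with hqdef
  have e : elementaryModule p μs fs ≃ₗ[IwasawaAlgebra p]
      ((⨁ i : Fin μs.length,
          IwasawaAlgebra p ⧸ Ideal.span {PowerSeries.C ((p : ℤ_[p]) ^ μs.get i)}) ×
        ⨁ j : Fin fs.length,
          IwasawaAlgebra p ⧸ Ideal.span {((fs.get j).1 : IwasawaAlgebra p) ^ (fs.get j).2}) :=
    LinearEquiv.refl _ _
  rw [Module.card_quotSMulTop_eq_of_linearEquiv
      (M' := ((⨁ i : Fin μs.length,
          IwasawaAlgebra p ⧸ Ideal.span {PowerSeries.C ((p : ℤ_[p]) ^ μs.get i)}) ×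
        ⨁ j : Fin fs.length,
          IwasawaAlgebra p ⧸ Ideal.span {((fs.get j).1 : IwasawaAlgebra p) ^ (fs.get j).2})) _ e,
    Module.card_prod_quotSMulTop
      (⨁ i : Fin μs.length, IwasawaAlgebra p ⧸ Ideal.span {PowerSeries.C ((p : ℤ_[p]) ^ μs.get i)})
      (⨁ j : Fin fs.length, IwasawaAlgebra p ⧸ Ideal.span {((fs.get j).1 : IwasawaAlgebra p) ^ (fs.get j).2})
      (Ideal.span {q}),
    Module.card_directSum_quotSMulTop, Module.card_directSum_quotSMulTop]
  -- the `p`-primary pieces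
  rw [Finset.prod_congr rfl fun i _ => by
      rw [card_quotient_quotSMulTop, sup_comm, card_quotient_span_coe_sup_span_C_pow p hQ],
    Finset.prod_pow_eq_pow_sum]
  -- the distinguished pieces
  rw [Finset.prod_congr rfl fun j _ => by rw [card_quotient_quotSMulTop, sup_comm]]
  -- the right-hand side, by multiplicativity
  have hcop' : ∀ b ∈ fs.map (fun f => (f.1 : IwasawaAlgebra p) ^ f.2), IsRelPrime b q := by
    intro b hb
    obtain ⟨f, hf, rfl⟩ := List.mem_map.mp hb
    exact IsRelPrime.pow_left (hcop f hf)
  rw [charElement, card_quotient_span_sup_span_mul p (PowerSeries.C ((p : ℤ_[p]) ^ μs.sum))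
      (isRelPrime_list_prod_left p _ hcop'),
    card_quotient_span_coe_sup_span_C_pow p hQ, card_quotient_span_sup_span_list_prod p _ hcop', List.map_map]
  have hprod := Fin.prod_univ_fun_getElem fs (fun f : ℤ_[p][X] × ℕ =>
    Nat.card (IwasawaAlgebra p ⧸ (Ideal.span {q} ⊔ Ideal.span {(f.1 : IwasawaAlgebra p) ^ f.2})))
  -- (`congr 1` closes the second factor by `hprod`, up to unfolding `List.get` / `Function.comp`)
  congr 1
  rw [← Finset.sum_mul]
  simp [Fin.sum_univ_getElem]

/-! ### §3 Finiteness of `Λ ⧸ (Q, f)` for `f` prime to a distinguished `Q` -/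

/-- **`Λ ⧸ (Q, f)` is finite** for `Q` distinguished and `f` relatively prime to `Q`: no height-one prime of `Λ`
contains `(Q, f)` — not `(p)` because `Q` is monic, not `(h)` (`h` distinguished irreducible) because `h ∣ Q`, `h ∣ f`
would make `h` a unit — so the finitely generated module `Λ ⧸ (Q, f)` is pseudo-null, i.e. finite.
[cite: NeukirchSchmidtWingberg2008, Ch. V §3 ((5.3.7)–(5.3.8), pseudo-null = finite)] [cite: Washington1997, §13.2 (Lemma 13.7)] -/
theorem finite_quotient_span_coe_sup_span {Q : ℤ_[p][X]}
    (hQ : Q.IsDistinguishedAt (IsLocalRing.maximalIdeal ℤ_[p])) {f : IwasawaAlgebra p}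
    (hf : IsRelPrime f (Q : IwasawaAlgebra p)) :
    Finite (IwasawaAlgebra p ⧸ (Ideal.span {(Q : IwasawaAlgebra p)} ⊔ Ideal.span {f})) := by
  set J : Ideal (IwasawaAlgebra p) := Ideal.span {(Q : IwasawaAlgebra p)} ⊔ Ideal.span {f} with hJ
  refine finite_of_isPseudoNull p (IwasawaAlgebra p ⧸ J) ?_
  rw [Module.isPseudoNull_iff]
  intro 𝔭 h𝔭 m
  suffices h : ∃ s ∈ J, s ∉ 𝔭.asIdeal by
    obtain ⟨s, hsJ, hs𝔭⟩ := h
    refine ⟨s, hs𝔭, ?_⟩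
    obtain ⟨x, rfl⟩ := Ideal.Quotient.mk_surjective m
    rw [Algebra.smul_def, Ideal.Quotient.algebraMap_eq, ← map_mul, Ideal.Quotient.eq_zero_iff_mem]
    exact J.mul_mem_right _ hsJ
  by_contra hall
  push Not at hall
  have hJ𝔭 : J ≤ 𝔭.asIdeal := fun s hs => hall s hs
  have hQ𝔭 : (Q : IwasawaAlgebra p) ∈ 𝔭.asIdeal :=
    hJ𝔭 (Ideal.mem_sup_left (Ideal.mem_span_singleton_self _))
  have hf𝔭 : f ∈ 𝔭.asIdeal := hJ𝔭 (Ideal.mem_sup_right (Ideal.mem_span_singleton_self _))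
  rcases eq_or_ne 𝔭.asIdeal ⊥ with h0 | h0
  · rw [h0, Ideal.mem_bot] at hQ𝔭
    exact coe_ne_zero_of_monic p hQ.monic hQ𝔭
  · have h1 : 𝔭.asIdeal.height = 1 :=
      le_antisymm h𝔭 (Order.one_le_iff_ne_zero.mpr (by rwa [Ne, Ideal.height_eq_zero_iff_eq_bot]))
    rcases eq_span_of_height_eq_one p 𝔭.asIdeal h1 with h𝔭p | ⟨h, -, -, h𝔭h⟩
    · rw [h𝔭p, Ideal.mem_span_singleton] at hQ𝔭
      exact not_C_dvd_coe_of_monic p hQ.monic hQ𝔭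
    · rw [h𝔭h, Ideal.mem_span_singleton] at hQ𝔭 hf𝔭
      have hu : IsUnit (h : IwasawaAlgebra p) := hf hf𝔭 hQ𝔭
      exact 𝔭.isPrime.ne_top (h𝔭h.trans (Ideal.span_singleton_eq_top.mpr hu))

/-! ### §4 The specialisation principle -/

/-- **THE SPECIALISATION PRINCIPLE (index currency).** For a finitely generated torsion `Λ`-module `N` there is
`B ≥ 1` such that for EVERY distinguished polynomial `Q` relatively prime to a generator `g` of `char N`:
`N ⧸ Q N` is finite, `#(Λ ⧸ (Q, char N)) ≤ B · #(N ⧸ Q N)` and `#(N ⧸ Q N) ≤ B · #(Λ ⧸ (Q, char N))`. Proof: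
structure theorem `θ : N → E(μs, fs)` with finite kernel and cokernel, `char N = (p^{Σμᵢ} ∏ fⱼ^{nⱼ})`, the exact count
`#(E ⧸ Q E) = #(Λ ⧸ (Q, char N))` and the index comparison along `θ` with `B = #ker θ · #coker θ` — uniform in `Q`.
At `Q` = the minimal polynomial of an algebraic point `x` of the open unit disc this reads
`#(N ⧸ Q N) ≍ |N_{ℚ_p(x)/ℚ_p}(g(x))|_p^{-1}`: the device by which a Kolyvagin-system bound at the height-one prime `(Q)`
becomes an inequality between values. [cite: MazurRubin2004, §5.3 (Thm. 5.3.10, proof: specialisation at height-one primes 𝔓 ≠ pΛ)]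
[cite: Howard2004HeegnerKolyvagin, proof of Thm. 2.2.10] [cite: Washington1997, §13.2 (Thm. 13.12)] -/
theorem exists_card_quotSMulTop_bounds_of_isRelPrime (N : Type*) [AddCommGroup N]
    [Module (IwasawaAlgebra p) N] [Module.Finite (IwasawaAlgebra p) N]
    (hN : Module.IsTorsion (IwasawaAlgebra p) N) :
    ∃ B : ℕ, 0 < B ∧ ∀ (Q : ℤ_[p][X]), Q.IsDistinguishedAt (IsLocalRing.maximalIdeal ℤ_[p]) →
      ∀ g : IwasawaAlgebra p, Module.charIdeal (IwasawaAlgebra p) N = Ideal.span {g} →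
        IsRelPrime g (Q : IwasawaAlgebra p) →
      Finite (N ⧸ (Ideal.span {(Q : IwasawaAlgebra p)} • ⊤ : Submodule (IwasawaAlgebra p) N)) ∧
      Nat.card (IwasawaAlgebra p ⧸
          (Ideal.span {(Q : IwasawaAlgebra p)} ⊔ Module.charIdeal (IwasawaAlgebra p) N)) ≤
        B * Nat.card (N ⧸ (Ideal.span {(Q : IwasawaAlgebra p)} • ⊤ : Submodule (IwasawaAlgebra p) N)) ∧
      Nat.card (N ⧸ (Ideal.span {(Q : IwasawaAlgebra p)} • ⊤ : Submodule (IwasawaAlgebra p) N)) ≤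
        B * Nat.card (IwasawaAlgebra p ⧸
          (Ideal.span {(Q : IwasawaAlgebra p)} ⊔ Module.charIdeal (IwasawaAlgebra p) N)) := by
  classical
  obtain ⟨μs, fs, -, hfs, θ, hθ⟩ := exists_isPseudoIsomorphism_elementary_holds p N hN
  have hfs' : ∀ f ∈ fs, f.1.IsDistinguishedAt (IsLocalRing.maximalIdeal ℤ_[p]) := fun f hf => (hfs f hf).1
  have hchar : Module.charIdeal (IwasawaAlgebra p) N = Ideal.span {charElement p μs fs} :=
    charIdeal_eq_span_holds p N hfs' ⟨θ, hθ⟩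
  set E := elementaryModule p μs fs with hEdef
  haveI : Module.Finite (IwasawaAlgebra p) E := moduleFinite_elementaryModule p μs fs
  haveI : IsNoetherian (IwasawaAlgebra p) N := isNoetherian_of_isNoetherianRing_of_finite _ _
  haveI : Finite (LinearMap.ker θ) := finite_of_isPseudoNull p (LinearMap.ker θ) hθ.1
  haveI : Finite (E ⧸ LinearMap.range θ) := finite_of_isPseudoNull p (E ⧸ LinearMap.range θ) hθ.2
  obtain ⟨B, hB, hcmp⟩ := hθ.exists_card_quotient_le p
  refine ⟨B, hB, fun Q hQ g hg hcop => ?_⟩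
  set q : IwasawaAlgebra p := (Q : IwasawaAlgebra p) with hqdef
  -- relative primality of the characteristic power series and of its factors
  have hassoc : Associated g (charElement p μs fs) :=
    Ideal.span_singleton_eq_span_singleton.mp (hg.symm.trans hchar)
  have hcopE : IsRelPrime (charElement p μs fs) q := by
    obtain ⟨u, hu⟩ := hassoc
    rw [← hu]
    exact IsRelPrime.mul_left hcop u.isUnit.isRelPrime_left
  have hcopf : ∀ f ∈ fs, IsRelPrime (f.1 : IwasawaAlgebra p) q := by
    intro f hf
    refine IsRelPrime.of_dvd_left hcopE ?_
    calc (f.1 : IwasawaAlgebra p) ∣ (f.1 : IwasawaAlgebra p) ^ f.2 := dvd_pow_self _ (hfs f hf).2.2.ne'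
      _ ∣ (fs.map fun f => (f.1 : IwasawaAlgebra p) ^ f.2).prod :=
          List.dvd_prod (List.mem_map.mpr ⟨f, hf, rfl⟩)
      _ ∣ charElement p μs fs := dvd_mul_left _ _
  -- the elementary side: exact count, finite
  have hE : Nat.card (E ⧸ (Ideal.span {q} • ⊤ : Submodule (IwasawaAlgebra p) E)) =
      Nat.card (IwasawaAlgebra p ⧸ (Ideal.span {q} ⊔ Module.charIdeal (IwasawaAlgebra p) N)) := by
    rw [hchar]
    exact card_elementaryModule_quotSMulTop_eq p hQ hcopf
  haveI hfin : Finite (IwasawaAlgebra p ⧸ (Ideal.span {q} ⊔ Module.charIdeal (IwasawaAlgebra p) N)) := by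
    rw [hchar]
    exact finite_quotient_span_coe_sup_span p hQ hcopE
  have hEfin : Finite (E ⧸ (Ideal.span {q} • ⊤ : Submodule (IwasawaAlgebra p) E)) :=
    Nat.finite_of_card_ne_zero (by rw [hE]; exact Nat.card_pos.ne')
  -- finiteness of `N ⧸ Q N` along `θ`
  have hEfin' : Finite (E ⧸ (q • ⊤ : Submodule (IwasawaAlgebra p) E)) :=
    Finite.of_equiv _ (Submodule.quotEquivOfEq _ _ (Submodule.ideal_span_singleton_smul q ⊤)).toEquiv
  have hNfin' : Finite (N ⧸ (q • ⊤ : Submodule (IwasawaAlgebra p) N)) :=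
    (LinearMap.finite_quotient_smul_top_iff_of_finite_ker_coker θ q).mpr hEfin'
  have hNfin : Finite (N ⧸ (Ideal.span {q} • ⊤ : Submodule (IwasawaAlgebra p) N)) :=
    Finite.of_equiv _ (Submodule.quotEquivOfEq _ _ (Submodule.ideal_span_singleton_smul q ⊤)).toEquiv.symm
  obtain ⟨h1, h2⟩ := hcmp q
  exact ⟨hNfin, hE ▸ h2, hE ▸ h1⟩

end IwasawaAlgebra

end Literature.NumberTheory.EllipticCurves

end
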